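import Mathlib
import Summits.Langlands.Langlands.Theses.PhantomRMYoshida
import Literature.NumberTheory.Automorphic.ChebotarevArtinRepHolds
import Literature.NumberTheory.GaloisRepresentations.FrobeniusDensity
import Literature.NumberTheory.GaloisRepresentations.ModNCyclotomicCharacter
import Literature.NumberTheory.GaloisRepresentations.GaloisRepFrobeniusProofs
import Literature.NumberTheory.GaloisRepresentations.ArtinRestriction
import HarnessLib

/-!
# Route `PhantomRMYoshida`, crux `StableYoshidaCongruence` (stmt-Langlands-13640), line
# `serre-dual-ribet-square`: Stub 4a `stub_crossPlaceOfCrossElement`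

Chebotarev SUPPLY of a cross-ratio PLACE from a cross-ratio ELEMENT.  Let `p` be an odd prime,
`k` a discrete algebraically closed field of characteristic `p`, `σ, σ' : Γ_ℚ → GL₂(k)`
continuous (hence of finite image), and `ε̄ : Γ_ℚ → (ℤ/p)ˣ` the mod-`p` cyclotomic character
(Mathlib `modularCyclotomicCharacter` on `ℚ̄`, composed with `Γ_ℚ → (ℚ̄ ≃+* ℚ̄)`; this is the
tree's `modNCyclotomicCharacter ℚ p`, definitionally).  If some `g ∈ Γ_ℚ` is CROSS-ONLY —
`charpoly σ(g) = (X-a)(X-b)`, `charpoly σ'(g) = (X-c)(X-d)`, one cross pair in ratio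
`e = ε̄(g)` read in `k` and no internal ratio `e^{±1}` — then there is a finite place `v ∤ p` of
`ℚ` at which `σ, σ'` are unramified, whose Frobenius polynomials (at every prime above `v` and
every arithmetic Frobenius) are `(X-a)(X-b)`, `(X-c)(X-d)`, with the same relations for the
ratio `q_v = N v` read in `k`.

Proof (Serre, *Abelian ℓ-adic representations*, Ch. I §2.2 Cor. 2 (a); Neukirch, *Algebraic
Number Theory*, Ch. I (10.3), Ch. VII §13).

1. `σ, σ'` have finite image (`Γ_ℚ` is compact, `GL₂(k)` is discrete), hence open kernel
   (`isOpen_ker_of_finite_range`) and are unramified outside a finite set of places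
   (`FramedGaloisRep.eventually_isUnramifiedAt_of_isOpen_ker`).  Let `S` be this set together
   with the place `p`.
2. `U = {h | σ h = σ g, σ' h = σ' g, ε̄ h = ε̄ g}` is open (`σ, σ'` and the `k`-valued mod-`p`
   cyclotomic character `modPCyclotomicCharacter ℚ k p _` are continuous into discrete spaces,
   hence locally constant) and contains `g`.
3. Arithmetic Frobenii at primes above places outside `S` are dense in `Γ_ℚ`
   (`absoluteGaloisGroup.frobenius_dense`, from the proved Chebotarev theorem
   `chebotarev_artinRep_holds`), so some arithmetic Frobenius `φ` at some `𝔓 ∣ v`, `v ∉ S`,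
   lies in `U`.
4. `ε̄(φ) = q_v (mod p)` (`modNCyclotomicCharacter_eq_residueCard_of_isArithFrobAt`: `φ` acts
   on `μ_p ⊂ ℤ̄` by `ζ ↦ ζ^{q_v}` modulo `𝔓`, and `p`-th roots of unity stay distinct modulo
   `𝔓 ∌ p`), so `e = ε̄(g) = ε̄(φ) ↦ (q_v : k)` under `ZMod.castHom`.
5. `σ` being unramified at `v`, every arithmetic Frobenius at every `𝔓' ∣ v` has the
   characteristic polynomial of `σ(φ) = σ(g)` (`GaloisRep.IsUnramifiedAt.hasFrobCharpolyAt_charpoly`,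
   transported to framed representations by `isUnramifiedAt_toGaloisRep_iff`,
   `hasFrobCharpolyAt_toGaloisRep_iff`); same for `σ'`.

Everything used is proved in the tree; no named fact is taken as a hypothesis.
-/

-- `Summit.Langlands.Langlands.…` (summit = sub-problem name, D-0017 layout) trips `dupNamespace` on every decl.
set_option linter.dupNamespace false

noncomputable section

open Literature.NumberTheory.GaloisRepresentations Literature.NumberTheory.Automorphic
open IsDedekindDomain Polynomial Field
open scoped NumberField

namespace Summit.Langlands.Langlands.Cruxes.StableYoshidaCongruence.SerreDualRibetSquare

/-- A continuous `ρ : Γ_ℚ → GL_n(k)` with `k` discrete has finite image (`Γ_ℚ` is compact and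
`GL_n(k)` is discrete). [folklore] -/
theorem finite_range_of_discreteTopology {k : Type} [Field k] [TopologicalSpace k]
    [DiscreteTopology k] {n : ℕ} (ρ : FramedGaloisRep ℚ k n) : Finite ρ.toMonoidHom.range := by
  have h : (Set.range ρ).Finite := (isCompact_range (map_continuous ρ)).finite_of_discrete
  have h4 : (ρ.toMonoidHom.range : Set (GL (Fin n) k)) = Set.range ρ := by
    rw [MonoidHom.coe_range]; rfl
  exact Set.finite_coe_iff.mpr (h4 ▸ h)

/-- A continuous `ρ : Γ_ℚ → GL_n(k)` with `k` discrete is unramified at all but finitely many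
places (finite image, open kernel, `FramedGaloisRep.eventually_isUnramifiedAt_of_isOpen_ker`).
[cite: SerreAbelianLadic1968, Ch. I §2.1] -/
theorem eventually_isUnramifiedAt_of_discreteTopology {k : Type} [Field k] [TopologicalSpace k]
    [DiscreteTopology k] {n : ℕ} (ρ : FramedGaloisRep ℚ k n) :
    ∀ᶠ v : HeightOneSpectrum (𝓞 ℚ) in Filter.cofinite, ρ.IsUnramifiedAt v := by
  haveI := finite_range_of_discreteTopology ρ
  exact ρ.eventually_isUnramifiedAt_of_isOpen_ker (isOpen_ker_of_finite_range ρ)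

/-- At an unramified place `v` of a framed representation `ρ : Γ_ℚ → GL_n(k)`, the characteristic
polynomial of ONE arithmetic Frobenius `φ` at ONE prime `𝔓 ∣ v` is the Frobenius polynomial at `v`
(all Frobenii at all primes above `v` are conjugate modulo inertia; tree
`GaloisRep.IsUnramifiedAt.hasFrobCharpolyAt_charpoly` transported to the framed avatar).
[cite: SerreAbelianLadic1968, Ch. I §2.1] -/
theorem hasFrobCharpolyAt_charpoly_of_isUnramifiedAt {k : Type} [Field k] [TopologicalSpace k]
    [IsTopologicalRing k] {n : ℕ} (ρ : FramedGaloisRep ℚ k n) {v : HeightOneSpectrum (𝓞 ℚ)}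
    (hv : ρ.IsUnramifiedAt v) {𝔓 : Ideal (absIntegers (𝓞 ℚ) ℚ)} (h𝔓 : 𝔓 ∈ v.primesAbove)
    {φ : absoluteGaloisGroup ℚ} (hφ : IsArithFrobAt (𝓞 ℚ) φ 𝔓) :
    ρ.HasFrobCharpolyAt v (FramedRep.charpoly ρ φ) := by
  have hQ : ρ.toGaloisRep.HasFrobCharpolyAt v (ρ.toGaloisRep φ).charpoly :=
    ((FramedGaloisRep.isUnramifiedAt_toGaloisRep_iff v ρ).mpr hv).hasFrobCharpolyAt_charpoly h𝔓 hφ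
  rw [FramedGaloisRep.hasFrobCharpolyAt_toGaloisRep_iff] at hQ
  intro 𝔓' h𝔓' φ' hφ'
  rw [hQ 𝔓' h𝔓' φ' hφ', ← hQ 𝔓 h𝔓 φ hφ]

/-- **Stub 4a (`stub_crossPlaceOfCrossElement`; Chebotarev supply of cross-ratio places).**
If some `g ∈ Γ_ℚ` is CROSS-ONLY for the pair — `charpoly σ(g) = (X-a)(X-b)`, `charpoly σ'(g) = (X-c)(X-d)` with
one cross pair in ratio `e = ε̄(g)` (`c = e a ∨ a = e c`) and no internal ratio (`a ≠ e^{±1} b`, `c ≠ e^{±1} d`,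
spelled as four inequations) — then there is a finite place `v ∤ p` at which `σ, σ'` are unramified with
Frobenius polynomials `(X-a)(X-b)`, `(X-c)(X-d)` forming a cross-only datum for the ratio `q_v`.
Proof: `U = {h : σ h = σ g, σ' h = σ' g, ε̄ h = ε̄ g}` is open (`σ, σ', ε̄` are continuous into
discrete groups) and contains `g`; arithmetic Frobenii at the places outside the finite set
`{p} ∪ ram(σ) ∪ ram(σ')` are dense (`absoluteGaloisGroup.frobenius_dense chebotarev_artinRep_holds`),
so some `Frob_𝔓 = φ ∈ U` with `𝔓 ∣ v ∤ p`; there `ε̄(φ) = q_v mod p`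
(`modNCyclotomicCharacter_eq_residueCard_of_isArithFrobAt`), so `e ↦ (q_v : k)`, and the charpolys
of ALL Frobenii at `v` agree with those of `σ(φ) = σ(g)`, `σ'(φ) = σ'(g)` (unramifiedness).
[cite: SerreAbelianLadic1968, Ch. I §2.2 (Chebotarev density, Cor. 2 (a)), §2.1]
[cite: NeukirchANT1999, Ch. I (10.3); Ch. VII §13] -/
theorem stub_crossPlaceOfCrossElement :
    ∀ (p : ℕ) [Fact p.Prime], p ≠ 2 → ∀ (k : Type) [Field k] [CharP k p] [IsAlgClosed k]
      [TopologicalSpace k] [DiscreteTopology k] (σ σ' : FramedGaloisRep ℚ k 2),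
      let εb : Field.absoluteGaloisGroup ℚ →* (ZMod p)ˣ :=
        (modularCyclotomicCharacter (AlgebraicClosure ℚ)
          (HasEnoughRootsOfUnity.natCard_rootsOfUnity (AlgebraicClosure ℚ) p)).comp
          (MulSemiringAction.toRingAut (Field.absoluteGaloisGroup ℚ) (AlgebraicClosure ℚ))
      (∃ (g : Field.absoluteGaloisGroup ℚ) (a b c d : k),
        FramedRep.charpoly σ g = (X - C a) * (X - C b) ∧
        FramedRep.charpoly σ' g = (X - C c) * (X - C d) ∧
        (c = ((Units.map (ZMod.castHom (dvd_refl p) k).toMonoidHom (εb g) : kˣ) : k) * a ∨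
          a = ((Units.map (ZMod.castHom (dvd_refl p) k).toMonoidHom (εb g) : kˣ) : k) * c) ∧
        (a ≠ ((Units.map (ZMod.castHom (dvd_refl p) k).toMonoidHom (εb g) : kˣ) : k) * b ∧
          b ≠ ((Units.map (ZMod.castHom (dvd_refl p) k).toMonoidHom (εb g) : kˣ) : k) * a ∧
          c ≠ ((Units.map (ZMod.castHom (dvd_refl p) k).toMonoidHom (εb g) : kˣ) : k) * d ∧
          d ≠ ((Units.map (ZMod.castHom (dvd_refl p) k).toMonoidHom (εb g) : kˣ) : k) * c)) →
      ∃ (v : HeightOneSpectrum (NumberField.RingOfIntegers ℚ)) (a b c d : k),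
        ((p : ℕ) : NumberField.RingOfIntegers ℚ) ∉ v.asIdeal ∧
        σ.IsUnramifiedAt v ∧ σ'.IsUnramifiedAt v ∧
        σ.HasFrobCharpolyAt v ((X - C a) * (X - C b)) ∧ σ'.HasFrobCharpolyAt v ((X - C c) * (X - C d)) ∧
        (c = (v.residueCard : k) * a ∨ a = (v.residueCard : k) * c) ∧
        (a ≠ (v.residueCard : k) * b ∧ b ≠ (v.residueCard : k) * a ∧
          c ≠ (v.residueCard : k) * d ∧ d ≠ (v.residueCard : k) * c) := by
  intro p _ hp k _ _ _ _ _ σ σ' εb hel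
  obtain ⟨g, a, b, c, d, hσg, hσ'g, hrel⟩ := hel
  -- (1) the finite exceptional set `S`: the place `p` and the ramified places of `σ, σ'`
  have hp0 : Ideal.span {((p : ℕ) : 𝓞 ℚ)} ≠ ⊥ := by
    rw [Ne, Ideal.span_singleton_eq_bot]
    exact_mod_cast (Fact.out : p.Prime).ne_zero
  set S : Set (HeightOneSpectrum (𝓞 ℚ)) := {v | ((p : ℕ) : 𝓞 ℚ) ∈ v.asIdeal} ∪
    {v | ¬ (σ.IsUnramifiedAt v ∧ σ'.IsUnramifiedAt v)} with hS
  have hS₀ : S.Finite := by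
    refine ((Ideal.finite_factors hp0).subset ?_).union (Filter.eventually_cofinite.1
      ((eventually_isUnramifiedAt_of_discreteTopology σ).and
        (eventually_isUnramifiedAt_of_discreteTopology σ')))
    exact fun v hv => Ideal.dvd_span_singleton.2 hv
  have hD := absoluteGaloisGroup.frobenius_dense chebotarev_artinRep_holds ℚ S hS₀
  -- (2) the open neighbourhood `U` of `g`
  set χ : absoluteGaloisGroup ℚ →ₜ* kˣ :=
    modPCyclotomicCharacter ℚ k p (ZMod.castHom (dvd_refl p) k) with hχ
  have hσl : IsLocallyConstant (σ : absoluteGaloisGroup ℚ → GL (Fin 2) k) :=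
    (IsLocallyConstant.iff_continuous _).2 (map_continuous σ)
  have hσ'l : IsLocallyConstant (σ' : absoluteGaloisGroup ℚ → GL (Fin 2) k) :=
    (IsLocallyConstant.iff_continuous _).2 (map_continuous σ')
  have hχl : IsLocallyConstant (χ : absoluteGaloisGroup ℚ → kˣ) :=
    (IsLocallyConstant.iff_continuous _).2 (map_continuous χ)
  set U : Set (absoluteGaloisGroup ℚ) :=
    {h | σ h = σ g} ∩ {h | σ' h = σ' g} ∩ {h | χ h = χ g} with hU
  have hUo : IsOpen U :=
    ((hσl.isOpen_fiber _).inter (hσ'l.isOpen_fiber _)).inter (hχl.isOpen_fiber _)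
  have hgU : g ∈ U := ⟨⟨rfl, rfl⟩, rfl⟩
  -- (3) a Frobenius `φ ∈ U` at a prime `𝔓` above a place `v ∉ S`
  obtain ⟨φ, hφU, v, hvS, 𝔓, h𝔓, hφ⟩ := hD.inter_open_nonempty U hUo ⟨g, hgU⟩
  obtain ⟨⟨h₁, h₂⟩, h₃⟩ := hφU
  simp only [hS, Set.mem_union, Set.mem_setOf_eq, not_or, not_not] at hvS
  obtain ⟨hpv, hσv, hσ'v⟩ := hvS
  -- (4) `ε̄(g) = ε̄(φ) = q_v` in `k`
  have hN : ((p : ℕ) : absIntegers (𝓞 ℚ) ℚ) ∉ 𝔓 := by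
    intro h
    apply hpv
    rw [h𝔓.2.over, Ideal.mem_under, map_natCast]
    exact h
  have hεφ : ((εb φ : (ZMod p)ˣ) : ZMod p) = v.residueCard :=
    modNCyclotomicCharacter_eq_residueCard_of_isArithFrobAt h𝔓 hN hφ
  have h₃' : Units.map (ZMod.castHom (dvd_refl p) k).toMonoidHom (εb φ) =
      Units.map (ZMod.castHom (dvd_refl p) k).toMonoidHom (εb g) := h₃
  have he : ((Units.map (ZMod.castHom (dvd_refl p) k).toMonoidHom (εb g) : kˣ) : k) =
      (v.residueCard : k) := by
    rw [← h₃', Units.coe_map, RingHom.toMonoidHom_eq_coe, MonoidHom.coe_coe, hεφ, map_natCast]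
  rw [he] at hrel
  -- (5) from one Frobenius to the place
  have hPσ : σ.HasFrobCharpolyAt v ((X - C a) * (X - C b)) := by
    have h := hasFrobCharpolyAt_charpoly_of_isUnramifiedAt σ hσv h𝔓 hφ
    have hc : FramedRep.charpoly σ φ = FramedRep.charpoly σ g := by
      unfold FramedRep.charpoly
      rw [h₁]
    rwa [hc, hσg] at h
  have hPσ' : σ'.HasFrobCharpolyAt v ((X - C c) * (X - C d)) := by
    have h := hasFrobCharpolyAt_charpoly_of_isUnramifiedAt σ' hσ'v h𝔓 hφ
    have hc : FramedRep.charpoly σ' φ = FramedRep.charpoly σ' g := by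
      unfold FramedRep.charpoly
      rw [h₂]
    rwa [hc, hσ'g] at h
  exact ⟨v, a, b, c, d, hpv, hσv, hσ'v, hPσ, hPσ', hrel⟩

end Summit.Langlands.Langlands.Cruxes.StableYoshidaCongruence.SerreDualRibetSquare

end
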